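import Summits.BirchSwinnertonDyer.BirchSwinnertonDyer.Theorems.KolyvaginRoadThreeMethod2Defs
import Summits.BirchSwinnertonDyer.BirchSwinnertonDyer.Theorems.ClassRecordThreeShimuraKolyvaginImageDisjoint
import Literature.NumberTheory.EllipticCurves.HeegnerPointsKolyvaginCebotarevProofs
import Literature.NumberTheory.EllipticCurves.HeegnerHypothesisKroneckerProofs
import Literature.NumberTheory.EllipticCurves.ModularityVersionApProofs
import Literature.NumberTheory.EllipticCurves.ModPIrreducibleCongruenceTransferProofs
import Literature.NumberTheory.EllipticCurves.BSDRankZeroDensity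
import HarnessLib

/-!
# Method 2 at `p = 3` — (Cheb) I: the unipotent target of the Čebotarev argument

Sub-problem `BirchSwinnertonDyer`, route `KolyvaginRoadThree`, METHOD line (koly v2x/v2y) on the crux
`ZhangSharpFrameAtThreeHL` (`stmt-BirchSwinnertonDyer-19574`), stub A `stub_levelRaisingAtThree`.  koly3a's reduction
(`selQ_rankLowering_on_of_localGlobal`) asks, among its inputs, (Cheb): for every non-zero class `x` of a good-level
eigen-Selmer space `Sel_n^μ ⊂ H¹(K, E[3])` a NEW unipotent-admissible prime `q ∉ n` with `Frob_q² ≠ 1` on `E[3]` and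
`loc_v x ≠ 0` at the place `v ∣ q` of `K`.  This file prepares the Čebotarev argument of the next file
(`KolyvaginRoadThreeMethod2Cheb`) — koly MEMO-v8 §4, the `p = 3` counterpart of W. Zhang 2014 Lemma 7.3 / Bertolini–Darmon
2005 Thm. 3.2 with the sign rule `ρ̄(Frob_q) = sgn μ · (1 + N')`:

* §1 `trace_det_of_sq_eq` — linear algebra on a plane: `f² = 2ν f − 1`, `f ≠ ν` (`ν² = 1`) force `tr f = 2ν`,
  `det f = 1` (Cayley–Hamilton).
* §2 `exists_prime_dvd_discr_not_dvd_three` — on the frame (K imaginary quadratic, `3` multiplicative for `E`, Heegner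
  hypothesis for `N_E`) some prime `q₀ ∣ d_K` has `q₀ ∤ 3 N_E` (split primes are unramified; `3 ∣ N_E` splits).
* §3 `exists_unipotent_target` — the TARGET: `g₁ ∈ Γ_K` and a square-zero `N' ≠ 0` on `E(K̄)[3]` with
  `T (g₁ Q) = ν (Q + N' Q)` (`T` = the involution of `E(K̄)[3]` induced by the lift `t = e c₀ e⁻¹` of complex
  conjugation) and `c₀ · res g₁` acting on `E(ℚ̄)[3] ≃ E(K̄)[3]` as `ν (1 + N')`.  Ingredients: a transvection of
  `E(K̄)[3] ≃ (ℤ/3)²` (`KolyvaginImage.shearX`), surjectivity of `ρ̄_{E,3}` on `Γ_ℚ` (`Surj W 3`), and Gross's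
  disjointness `K ∩ ℚ(E[3]) = ℚ` in the form `exists_absGaloisRestrict_smul_eq` (seat shim3b, file
  `ClassRecordThreeShimuraKolyvaginImageDisjoint`) at the ramified prime `q₀` of §2.
* §4 `mod_three_and_trace_of_frob` — if an arithmetic Frobenius above a good prime `q ≠ 3` acts on `E(ℚ̄)[3]` as
  `ν (1 + N')`, then `q ≡ 1 (mod 3)` and `3 ∤ a_q` (`det = q`, `tr = a_q` on `E[3]`: the tree's
  `det_galoisRepTorsion_frobenius_eq`, `trace_galoisRepTorsion_frobenius_eq`, and §1) — the two congruence clauses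
  of `IsUAdmissiblePrime`.
* §5 an algebra lemma (Bézout in a `p`-torsion group; `H¹(K, E[n])` is `n`-torsion by the tree's
  `zsmul_galH1Torsion_eq_zero`).

References: [cite: WZhang2014, Lemma 7.3, Notations (xii)] [cite: BertoliniDarmon2005, Thm. 3.2]
[cite: GrossLMS1991, §9 Prop. 9.1, 9.3] [cite: Serre1981, §8.1 eq. (238)].
-/

noncomputable section

open scoped Classical Pointwise
open Polynomial

namespace Summit.BirchSwinnertonDyer.Rank1Residual.X11b.Three.Koly.Method2.Cheb

open WeierstrassCurve Field Function NumberField IsDedekindDomain Rat.HeightOneSpectrum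
open Literature.NumberTheory.EllipticCurves Literature.NumberTheory.GaloisRepresentations Module
open Summit.BirchSwinnertonDyer.BirchSwinnertonDyer.Theorems

/-! ## §1 Linear algebra: trace and determinant of a non-trivial `ν`-unipotent of a plane -/

section Plane

variable {k : Type*} [Field k] {V : Type*} [AddCommGroup V] [Module k V] [FiniteDimensional k V]

/-- On a `2`-dimensional space the characteristic polynomial of an endomorphism `f` is
`X² − tr(f) X + det(f)` (Mathlib `Matrix.charpoly_fin_two` in a basis). [folklore] -/
private theorem charpoly_eq_of_finrank_eq_two (h2 : Module.finrank k V = 2) (f : Module.End k V) :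
    f.charpoly = X ^ 2 - C (LinearMap.trace k V f) * X + C (LinearMap.det f) := by
  let b := Module.finBasisOfFinrankEq k V h2
  rw [← LinearMap.charpoly_toMatrix f b, Matrix.charpoly_fin_two,
    ← LinearMap.trace_eq_matrix_trace k b f, LinearMap.det_toMatrix b f]

/-- Cayley–Hamilton in dimension `2`, pointwise: `f (f x) = tr(f) • f x - det(f) • x`. [folklore] -/
private theorem apply_apply_eq_of_finrank_eq_two (h2 : Module.finrank k V = 2) (f : Module.End k V) (x : V) :
    f (f x) = LinearMap.trace k V f • f x - LinearMap.det f • x := by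
  have hCH := LinearMap.aeval_self_charpoly f
  rw [charpoly_eq_of_finrank_eq_two h2, map_add, map_sub, map_mul, aeval_C, aeval_C, map_pow, aeval_X] at hCH
  have h := congrArg (fun g : Module.End k V => g x) hCH
  simp only [LinearMap.add_apply, LinearMap.sub_apply, LinearMap.zero_apply, Module.End.mul_apply,
    pow_two, Module.algebraMap_end_apply] at h
  rw [sub_add_eq_add_sub, sub_eq_zero] at h
  rw [eq_sub_iff_add_eq]
  rw [← h]

/-- **Trace and determinant of a non-scalar `ν`-unipotent of a plane.**  If `f² = 2ν f − 1` (i.e.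
`(f − ν)² = 0` for `ν² = 1`) and `f ≠ ν`, then `tr f = 2ν` and `det f = 1`. [folklore] -/
theorem trace_det_of_sq_eq (h2 : Module.finrank k V = 2) (f : Module.End k V) (ν : k) (hν : ν * ν = 1)
    (hf : ∀ x, f (f x) = (2 * ν) • f x - x) (hne : ∃ x, f x ≠ ν • x) :
    LinearMap.trace k V f = 2 * ν ∧ LinearMap.det f = 1 := by
  obtain ⟨x₀, hx₀⟩ := hne
  have hx₀0 : x₀ ≠ 0 := by
    rintro rfl
    exact hx₀ (by rw [map_zero, smul_zero])
  set t := LinearMap.trace k V f with ht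
  set d := LinearMap.det f with hd
  -- `(2ν − t) • f x = (1 − d) • x`
  have key : ∀ x, (2 * ν - t) • f x = (1 - d) • x := fun x ↦ by
    have h1 := apply_apply_eq_of_finrank_eq_two h2 f x
    rw [hf x] at h1
    rw [sub_smul, sub_smul, one_smul, sub_eq_sub_iff_add_eq_add]
    have : (2 * ν) • f x - x = t • f x - d • x := h1
    rw [sub_eq_sub_iff_add_eq_add] at this
    rw [this, add_comm]
  by_cases htr : t = 2 * ν
  · refine ⟨htr, ?_⟩
    have h1 := key x₀
    rw [htr, sub_self, zero_smul] at h1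
    have h2' : (1 - d) = 0 := by
      by_contra hne'
      exact hx₀0 ((smul_eq_zero.mp h1.symm).resolve_left hne')
    exact (sub_eq_zero.mp h2').symm
  · exfalso
    have h2ν : (2 * ν - t) ≠ 0 := fun h ↦ htr (sub_eq_zero.mp h).symm
    set c := (2 * ν - t)⁻¹ * (1 - d) with hc
    have hfc : ∀ x, f x = c • x := fun x ↦ by
      have h1 := key x
      have := congrArg (fun y => (2 * ν - t)⁻¹ • y) h1
      simp only [smul_smul, inv_mul_cancel₀ h2ν, one_smul] at this
      rw [this, hc]
    -- `c² − 2νc + 1 = 0`, i.e. `(c − ν)² = 0`, so `c = ν`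
    have hpoly : (c * c - 2 * ν * c + 1) • x₀ = 0 := by
      have h1 := hf x₀
      rw [hfc, hfc, smul_smul] at h1
      rw [add_smul, sub_smul, one_smul, h1, mul_smul, mul_smul]
      simp only [smul_smul]
      abel_nf
      module
    have hc0 : c * c - 2 * ν * c + 1 = 0 := by
      by_contra hne'
      exact hx₀0 ((smul_eq_zero.mp hpoly).resolve_left hne')
    have hcν : (c - ν) ^ 2 = 0 := by
      have : (c - ν) ^ 2 = c * c - 2 * ν * c + 1 := by rw [← hν]; ring
      rw [this, hc0]
    have hcν' : c = ν := by
      have := pow_eq_zero_iff (n := 2) (by norm_num) |>.mp hcν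
      exact sub_eq_zero.mp this
    exact hx₀ (by rw [hfc, hcν'])

end Plane

/-! ## §2 A ramified prime away from `3N` -/

section Ramified

variable (W : WeierstrassCurve ℚ) (K : Type) [Field K] [NumberField K] [W.IsElliptic]

/-- **A ramified prime away from `3 N_E`.**  For `K` imaginary quadratic, `E = W/ℚ` with multiplicative reduction
at `3` and `N_E` satisfying the Heegner hypothesis in `K`, some prime `q ∣ d_K` divides neither `N_E` nor `3`:
primes dividing `N_E` split in `K` (`SatisfiesHeegnerHypothesis.not_dvd_discr`), in particular `3 ∣ N_E` does,
while `q` ramifies. [cite: GrossLMS1991, §9 (PDF p. 227, «D prime to Np»)] -/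
theorem exists_prime_dvd_discr_not_dvd_three (hK : IsImaginaryQuadratic K)
    (hmult : W.HasMultiplicativeReductionAtPrime 3) (hH : SatisfiesHeegnerHypothesis (W.conductorNorm ℤ) K) :
    ∃ q : ℕ, q.Prime ∧ (q : ℤ) ∣ NumberField.discr K ∧ ¬ q ∣ W.conductorNorm ℤ ∧ ¬ (q : ℤ) ∣ ((3 : ℕ) : ℤ) := by
  haveI : Fact (Nat.Prime 3) := ⟨Nat.prime_three⟩
  obtain ⟨q, hq, hqd⟩ := ShimuraKolyvaginImageDisjoint.exists_prime_dvd_discr K (by rw [hK.1]; exact one_lt_two)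
  have hqN : ¬ q ∣ W.conductorNorm ℤ := fun h ↦
    Literature.SatisfiesHeegnerHypothesis.not_dvd_discr hK.1 hH hq h hqd
  have h3N : 3 ∣ W.conductorNorm ℤ :=
    (W.dvd_conductorNorm_iff_not_hasGoodReductionAtPrime 3).mpr
      (WeierstrassCurve.HasMultiplicativeReduction.not_hasGoodReduction (R := ℤ_[3]) hmult)
  have hq3 : q ≠ 3 := by rintro rfl; exact hqN h3N
  refine ⟨q, hq, hqd, hqN, fun h ↦ hq3 ?_⟩
  have h' : q ∣ 3 := by exact_mod_cast h
  exact (Nat.prime_dvd_prime_iff_eq hq Nat.prime_three).mp h'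

end Ramified

/-! ## §3 The unipotent target: `g₁ ∈ Γ_K` with `c₀ · res g₁` acting on `E[3]` as `ν (1 + N')` -/

section Target

variable (W : WeierstrassCurve ℚ) (K : Type) [Field K] [NumberField K] [W.IsElliptic] [W.IsGloballyMinimal]

omit [W.IsGloballyMinimal] in
/-- **The unipotent target of the Čebotarev argument.**  On the frame (`K` imaginary quadratic, `ρ̄_{E,3}` onto,
`3` multiplicative, Heegner hypothesis), for the lift `t = e c₀ e⁻¹` of the complex conjugation `c` of `K`
(`IsLiftOfAut c t`, `t² = 1`) and a sign `ν = ±1`, there are `g₁ ∈ Γ_K` and an additive `N'` on `E(K̄)[3]` with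
`N'² = 0`, `N' ≠ 0`, `T (g₁ Q) = ν (Q + N' Q)` for all `Q` (`T` the involution of `E(K̄)[3]` induced by `t`), and
`c₀ · res(g₁)` acting on `E(ℚ̄)[3]`, read in `E(K̄)[3]` through `RatClosure.torsionEquiv`, as `ν (1 + N')`.
Construction: `N' = U − 1` for the transvection `U` of `E(K̄)[3] ≃ (ℤ/3)²` (`KolyvaginImage.shearX 1`); the
automorphism `θ⁻¹ T (ν U) θ` of `E(ℚ̄)[3]` is `ρ̄(γ_M)` for some `γ_M ∈ Γ_ℚ` (`Surj W 3`), and `γ_M` acts on `E[3]`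
as some `res g₁`, `g₁ ∈ Γ_K` (Gross's disjointness at a ramified prime `q₀ ∤ 3N_E`,
`ShimuraKolyvaginImageDisjoint.exists_absGaloisRestrict_smul_eq`). [cite: GrossLMS1991, §9 (PDF p. 227)]
[cite: WZhang2014, Lemma 7.3 (proof)] -/
theorem exists_unipotent_target (hK : IsImaginaryQuadratic K)
    (hsurj : Literature.NumberTheory.EllipticCurves.Rank1Residual.Surj W 3)
    (hmult : W.HasMultiplicativeReductionAtPrime 3) (hH : SatisfiesHeegnerHypothesis (W.conductorNorm ℤ) K)
    {c : K ≃ₐ[ℚ] K} {c₀ : absoluteGaloisGroup ℚ}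
    (ht : IsLiftOfAut c (absGaloisTransport (K := ℚ) (L := K) c₀).toRingEquiv)
    (hinv : ∀ x, (absGaloisTransport (K := ℚ) (L := K) c₀).toRingEquiv
      ((absGaloisTransport (K := ℚ) (L := K) c₀).toRingEquiv x) = x)
    {ν : ℤ} (hν : ν = 1 ∨ ν = -1) :
    ∃ (g₁ : absoluteGaloisGroup K)
      (N' : geomTorsion (W.baseChange K) ((3 : ℕ) : ℤ) →+ geomTorsion (W.baseChange K) ((3 : ℕ) : ℤ)),
      (∀ Q, N' (N' Q) = 0) ∧ (∃ Q, N' Q ≠ 0) ∧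
      (∀ Q, ht.torsionMap W ((3 : ℕ) : ℤ) (g₁ • Q) = ν • (Q + N' Q)) ∧
      (∀ P : geomTorsion W ((3 : ℕ) : ℤ),
        RatClosure.torsionEquiv (K := K) W ((3 : ℕ) : ℤ) ((c₀ * absGaloisRestrict ℚ K g₁) • P) =
          ν • (RatClosure.torsionEquiv (K := K) W ((3 : ℕ) : ℤ) P +
            N' (RatClosure.torsionEquiv (K := K) W ((3 : ℕ) : ℤ) P))) := by
  haveI : Fact (Nat.Prime 3) := ⟨Nat.prime_three⟩
  set n : ℤ := ((3 : ℕ) : ℤ) with hn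
  have hνν : ν * ν = 1 := by rcases hν with rfl | rfl <;> norm_num
  -- ### `E(K̄)[3] ≃ (ℤ/3)²`
  have hT3 : ∀ P : geomTorsion (W.baseChange K) n, 3 • P = 0 := fun P ↦ by
    have := (mem_geomTorsion_iff (W.baseChange K) n _).mp P.2
    apply Subtype.ext
    rw [AddSubgroupClass.coe_nsmul, ← natCast_zsmul]
    exact this
  have hcard : Nat.card (geomTorsion (W.baseChange K) n) = 3 ^ 2 :=
    card_torsionPoints_eq_sq_holds (W.baseChange K) (AlgebraicClosure K) (n := 3) (by norm_num)
  obtain ⟨eT⟩ := KolyvaginImage.nonempty_addEquiv_of_card_eq_sq (p := 3) hT3 hcard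
  -- ### the transvection `U` and `N' = U − 1`
  set U : geomTorsion (W.baseChange K) n ≃+ geomTorsion (W.baseChange K) n :=
    KolyvaginImage.transport eT (KolyvaginImage.shearX 1) with hU
  set N' : geomTorsion (W.baseChange K) n →+ geomTorsion (W.baseChange K) n :=
    U.toAddMonoidHom - AddMonoidHom.id _ with hN'
  have hN'apply : ∀ Q, N' Q = U Q - Q := fun Q ↦ rfl
  have hUQ : ∀ Q, U Q = Q + N' Q := fun Q ↦ by rw [hN'apply, add_sub_cancel]
  have hN'coord : ∀ Q, eT (N' Q) = ![eT Q 1, 0] := fun Q ↦ by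
    rw [hN'apply, map_sub, hU, KolyvaginImage.transport_apply, AddEquiv.apply_symm_apply]
    ext i
    fin_cases i
    · simp [KolyvaginImage.shearX]
    · simp [KolyvaginImage.shearX]
  have hN'N' : ∀ Q, N' (N' Q) = 0 := fun Q ↦ by
    apply eT.injective
    rw [hN'coord, map_zero]
    ext i
    fin_cases i
    · simp [hN'coord]
    · simp
  have hN'ne : ∃ Q, N' Q ≠ 0 := by
    refine ⟨eT.symm ![0, 1], fun h ↦ ?_⟩
    have := congrArg eT h
    rw [hN'coord, AddEquiv.apply_symm_apply, map_zero] at this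
    have h1 := congrFun this 0
    simp at h1
  -- ### the involution `T` of `E(K̄)[3]` induced by the lift of `c`, as an additive equivalence
  set T := ht.torsionMap W n with hTdef
  have hTT : ∀ Q, T (T Q) = Q := ht.torsionMap_torsionMap W hinv n
  set Teq : geomTorsion (W.baseChange K) n ≃+ geomTorsion (W.baseChange K) n :=
    { toFun := T, invFun := T, left_inv := hTT, right_inv := hTT, map_add' := fun a b ↦ map_add T a b }
    with hTeq
  -- ### `A = ν U` as an additive automorphism
  set A : geomTorsion (W.baseChange K) n ≃+ geomTorsion (W.baseChange K) n :=
    { toFun := fun Q ↦ ν • U Q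
      invFun := fun Q ↦ U.symm (ν • Q)
      left_inv := fun Q ↦ by simp only [smul_smul, hνν, one_smul, AddEquiv.symm_apply_apply]
      right_inv := fun Q ↦ by simp only [AddEquiv.apply_symm_apply, smul_smul, hνν, one_smul]
      map_add' := fun a b ↦ by simp only [map_add, smul_add] } with hA
  have hAapply : ∀ Q, A Q = ν • (Q + N' Q) := fun Q ↦ by rw [← hUQ]; rfl
  -- ### `γ_M ∈ Γ_ℚ` acting on `E(ℚ̄)[3]` as `θ⁻¹ T A θ` (surjectivity of `ρ̄_{E,3}`)
  set θ := RatClosure.torsionEquiv (K := K) W n with hθ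
  set A₀ : geomTorsion W n ≃+ geomTorsion W n := θ.trans ((A.trans Teq).trans θ.symm) with hA₀
  have hA₀apply : ∀ P, A₀ P = θ.symm (T (A (θ P))) := fun P ↦ rfl
  have hsurj' : Function.Surjective (galoisRepTorsion W n) := hsurj
  obtain ⟨γM, hγM⟩ := hsurj' (Multiplicative.ofAdd A₀)
  have hγM' : ∀ P : geomTorsion W n, γM • P = A₀ P := fun P ↦ by
    rw [← galoisRepTorsion_apply, hγM]; rfl
  -- ### `g₁ ∈ Γ_K` acting on `E(ℚ̄)[3]` as `γ_M` (Gross's disjointness at a ramified prime)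
  obtain ⟨q₀, hq₀, hq₀d, hq₀N, hq₀3⟩ := exists_prime_dvd_discr_not_dvd_three W K hK hmult hH
  obtain ⟨g₁, hg₁⟩ :=
    ShimuraKolyvaginImageDisjoint.exists_absGaloisRestrict_smul_eq W K hK.1 hq₀ hq₀d hq₀N hq₀3 γM
  have hG : ∀ Q, T (g₁ • Q) = ν • (Q + N' Q) := fun Q ↦ by
    obtain ⟨P, rfl⟩ := θ.surjective Q
    rw [← RatClosure.torsionEquiv_smul, hg₁, hγM', hA₀apply, ← hθ, θ.apply_symm_apply, hTT, hAapply]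
  refine ⟨g₁, N', hN'N', hN'ne, hG, fun P ↦ ?_⟩
  rw [mul_smul, RatClosure.torsionEquiv_smul_of_lift W ht c₀ (fun _ ↦ rfl) n, RatClosure.torsionEquiv_smul]
  exact hG _

end Target

/-! ## §4 The prime below a Frobenius of the target shape is unipotent-admissible -/

section Admissible

/-- `2ν ≠ 0` in `ZMod 3` for `ν = ±1`. [folklore] -/
private theorem zmod3_two_mul_sign_ne_zero :
    (0 : ZMod 3) ≠ 2 * ((1 : ℤ) : ZMod 3) ∧ (0 : ZMod 3) ≠ 2 * ((-1 : ℤ) : ZMod 3) := by decide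

variable (W : WeierstrassCurve ℚ) [W.IsElliptic] [W.IsGloballyMinimal]

/-- **The prime below a Frobenius of the target shape satisfies the two congruences of `IsUAdmissiblePrime`.**
If `γ ∈ Γ_ℚ` is an arithmetic Frobenius at a prime above the good prime `q ≠ 3` of `E = W/ℚ` (global minimal
form) and acts on `E(ℚ̄)[3]`, read through an additive isomorphism `θ`, as `ν (1 + N')` with `N'² = 0 ≠ N'` and
`ν = ±1`, then `q ≡ 1 (mod 3)` and `3 ∤ a_q`: on the `𝔽₃`-plane `E[3]`, `det ρ̄(γ) = q` and `tr ρ̄(γ) = a_q`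
(`det_galoisRepTorsion_frobenius_eq`, `trace_galoisRepTorsion_frobenius_eq`), while `ρ̄(γ)² = 2ν ρ̄(γ) − 1` and
`ρ̄(γ) ≠ ν` give `det = 1`, `tr = 2ν ≠ 0` (§1). [cite: Serre1981, §8.1 eq. (238)]
[cite: DarmonDiamondTaylor1995, Prop. 2.8 (a)] -/
theorem mod_three_and_trace_of_frob {q : ℕ} [Fact q.Prime] (hq3 : q ≠ 3)
    (hgood : W.HasGoodReductionAtPrime q) {v : HeightOneSpectrum (𝓞 ℚ)} (hv : (primesEquiv v : ℕ) = q)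
    {𝔓 : Ideal (absIntegers (𝓞 ℚ) ℚ)} (h𝔓 : 𝔓 ∈ v.primesAbove)
    {γ : absoluteGaloisGroup ℚ} (hγ : IsArithFrobAt (𝓞 ℚ) γ 𝔓)
    {M : Type*} [AddCommGroup M] (θ : geomTorsion W ((3 : ℕ) : ℤ) ≃+ M) (N' : M →+ M)
    (hN'N' : ∀ Q, N' (N' Q) = 0) (hN'ne : ∃ Q, N' Q ≠ 0) {ν : ℤ} (hν : ν = 1 ∨ ν = -1)
    (hact : ∀ P, θ (γ • P) = ν • (θ P + N' (θ P))) :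
    q % 3 = 1 ∧ ¬ 3 ∣ (W.frobeniusTrace q).natAbs := by
  haveI : Fact (Nat.Prime 3) := ⟨Nat.prime_three⟩
  letI : Module (ZMod 3) (geomTorsion W ((3 : ℕ) : ℤ)) := AddSubgroup.torsionBy.zmodModule
  set f := (galoisRepTorsion W 3 γ).toAdd.toAddMonoidHom.toZModLinearMap 3 with hfdef
  have hf : ∀ Q : geomTorsion W ((3 : ℕ) : ℤ), f Q = γ • Q := fun Q => rfl
  have htr : LinearMap.trace (ZMod 3) _ f = (W.frobeniusTrace q : ZMod 3) :=
    W.trace_galoisRepTorsion_frobenius_eq 3 hq3 hgood hv h𝔓 hγ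
  have hdet : LinearMap.det f = (q : ZMod 3) := W.det_galoisRepTorsion_frobenius_eq 3 hq3 hgood hv h𝔓 hγ
  have h2 : Module.finrank (ZMod 3) (geomTorsion W ((3 : ℕ) : ℤ)) = 2 :=
    Literature.RepresentationTheory.FiniteGroups.Representation.finrank_eq_two_of_natCard_eq_sq
      (card_torsionPoints_eq_sq_holds W (AlgebraicClosure ℚ) (n := 3) (by norm_num))
  haveI : FiniteDimensional (ZMod 3) (geomTorsion W ((3 : ℕ) : ℤ)) := Module.finite_of_finrank_eq_succ h2
  have hνν : ν * ν = 1 := by rcases hν with rfl | rfl <;> norm_num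
  have hννZ : (ν : ZMod 3) * (ν : ZMod 3) = 1 := by rw [← Int.cast_mul, hνν, Int.cast_one]
  -- `γ² = 2ν γ − 1` on `E(ℚ̄)[3]`, read through `θ`
  have hνX : ∀ X : M, ν • ν • X = X := fun X ↦ by rw [smul_smul, hνν, one_smul]
  have hsq : ∀ P : geomTorsion W ((3 : ℕ) : ℤ), γ • γ • P = (2 * ν) • γ • P - P := fun P ↦ by
    apply θ.injective
    have hL : θ (γ • γ • P) = θ P + N' (θ P) + N' (θ P) := by
      rw [hact, hact, map_zsmul, map_add, hN'N', add_zero, smul_add, hνX, hνX]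
    have hR : θ ((2 * ν) • γ • P - P) = θ P + N' (θ P) + N' (θ P) := by
      rw [map_sub, map_zsmul, hact, mul_smul, hνX, two_smul]
      abel
    rw [hL, hR]
  have hf2 : ∀ x, f (f x) = (2 * (ν : ZMod 3)) • f x - x := fun x ↦ by
    rw [hf, hf, hsq, show (2 * (ν : ZMod 3)) = ((2 * ν : ℤ) : ZMod 3) by push_cast; ring,
      Int.cast_smul_eq_zsmul]
  have hne : ∃ x, f x ≠ (ν : ZMod 3) • x := by
    obtain ⟨Q, hQ⟩ := hN'ne
    refine ⟨θ.symm Q, fun h ↦ hQ ?_⟩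
    rw [hf, Int.cast_smul_eq_zsmul] at h
    have := congrArg θ h
    rw [hact, θ.apply_symm_apply, map_zsmul, θ.apply_symm_apply, smul_add, add_eq_left] at this
    rcases hν with rfl | rfl
    · simpa using this
    · simpa using this
  obtain ⟨htr2, hdet1⟩ := trace_det_of_sq_eq h2 f (ν : ZMod 3) hννZ hf2 hne
  have hdet' : (q : ZMod 3) = 1 := hdet.symm.trans hdet1
  have htr' : (W.frobeniusTrace q : ZMod 3) = 2 * (ν : ZMod 3) := htr.symm.trans htr2
  constructor
  · have := congrArg ZMod.val hdet'
    rwa [ZMod.val_natCast, ZMod.val_one] at this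
  · intro h3
    have h0 : (W.frobeniusTrace q : ZMod 3) = 0 :=
      (ZMod.intCast_zmod_eq_zero_iff_dvd _ 3).mpr (Int.natCast_dvd.mpr h3)
    rw [h0] at htr'
    rcases hν with rfl | rfl
    · exact zmod3_two_mul_sign_ne_zero.1 htr'
    · exact zmod3_two_mul_sign_ne_zero.2 htr'

end Admissible

/-! ## §5 Two algebra lemmas -/

section Torsion

variable {K : Type} [Field K] [NumberField K] (W : WeierstrassCurve K)

/-- In a group killed by the prime `p`, `m • x = 0` with `p ∤ m` forces `x = 0` (Bézout; a copy of the
tree's `eq_zero_of_zsmul_eq_zero_of_not_dvd`, file `HeegnerPointsKolyvaginProp82LocalProofs`). [folklore] -/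
theorem eq_zero_of_zsmul_eq_zero_of_not_dvd' {T : Type*} [AddCommGroup T] {p : ℕ} (hp : p.Prime)
    (hT : ∀ x : T, (p : ℤ) • x = 0) {m : ℤ} (hm : ¬ (p : ℤ) ∣ m) {x : T} (hx : m • x = 0) : x = 0 := by
  have hcop : Int.gcd m p = 1 := by
    have hnd : ¬ p ∣ m.natAbs := fun h ↦ hm (Int.natCast_dvd.mpr h)
    rw [Int.gcd_eq_natAbs, Int.natAbs_natCast, Nat.gcd_comm]
    exact (Nat.Prime.coprime_iff_not_dvd hp).mpr hnd
  have hbez := Int.gcd_eq_gcd_ab m p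
  rw [hcop, Nat.cast_one] at hbez
  calc x = (1 : ℤ) • x := (one_zsmul x).symm
    _ = (m * Int.gcdA m p + p * Int.gcdB m p) • x := by rw [← hbez]
    _ = Int.gcdA m p • (m • x) + Int.gcdB m p • ((p : ℤ) • x) := by
        rw [add_zsmul, mul_comm m, mul_comm (p : ℤ), mul_zsmul, mul_zsmul]
    _ = 0 := by rw [hx, hT x, zsmul_zero, zsmul_zero, add_zero]

end Torsion

end Summit.BirchSwinnertonDyer.Rank1Residual.X11b.Three.Koly.Method2.Cheb

end
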